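import Summits.RiemannHypothesis.RiemannHypothesis.Theses.ScrewLasso
import HarnessLib

/-!
# Route ScrewLasso (L25 «LASSO», X-13) — `Assembly` (item stmt-RiemannHypothesis-22295)

`LassoFlux → ChargeContinuity → LassoFine → CeilAll → RiemannHypothesis` is four lines of logic: feed
`ChargeContinuity` with, at each fine step `h` supplied by `LassoFine`, the vanishing flux given by `LassoFlux`
(ceiling from `CeilAll`, lasso from `LassoFine`). This is the planner's kernel-checked `assembly_holds`
(rh-idea-1 g0, lasso/Sketch3.lean sha16 a2d1a9d9ee04ae7f; decls == the rendered route file), written against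
the route decls. CONDITIONAL bookkeeping: the route's cruxes `LassoFlux`, `ChargeContinuity`, `LassoFine` stay
OPEN — RH is not proved by this; nothing here bears on the truth of RH.
-/

-- D-0017: `Summit.RiemannHypothesis.RiemannHypothesis.…` duplicates the namespace BY DESIGN (single-problem summit).
set_option linter.dupNamespace false

namespace Summit.RiemannHypothesis.RiemannHypothesis.Theorems.ScrewLasso

open Summit.RiemannHypothesis.RiemannHypothesis.Theses.ScrewLasso in
/-- **`Assembly` (item stmt-RiemannHypothesis-22295) holds**: given the four items, `ChargeContinuity`
applies to the sequence of fine steps `h ∈ (0, δ)` from `LassoFine`, at each of which `LassoFlux` (with the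
ceiling `CeilAll h` and the lasso) makes the total disc flux vanish. Pure logic (planner rh-idea-1's
`assembly_holds`, a2d1a9d9). -/
theorem assembly_proof :
    Summit.RiemannHypothesis.RiemannHypothesis.Theses.ScrewLasso.Assembly := by
  intro h₁ h₂ h₃ h₄
  refine h₂ fun δ hδ ↦ ?_
  obtain ⟨h, hh, hl⟩ := h₃ δ hδ
  exact ⟨h, hh, h₁ h hh.1 (h₄ h hh.1) hl⟩

end Summit.RiemannHypothesis.RiemannHypothesis.Theorems.ScrewLasso
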